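import Mathlib

/-!
# Discrete Coppel inequality: products of propagators in moving frames
(solo-blind, PLATEAU (PL-2) / bridge (B2): adiabatic and complement bounds for the monodromy, paper §24.95(7))

The leaf monodromy is a product `Φ = M_{N-1} ∘ ⋯ ∘ M_0` of short-time propagators.  Given invertible
"frames" `V_0, …, V_N` (e.g. the frozen eigenbases, or a slow/complement splitting at the grid times)
one has the telescoping identity
`Φ = V_N ∘ (Ñ_{N-1} ∘ ⋯ ∘ Ñ_0) ∘ V_0⁻¹`, `Ñ_i := V_{i+1}⁻¹ ∘ M_i ∘ V_i`,
hence `‖Φ‖ ≤ ‖V_N‖ · ‖V_0⁻¹‖ · ∏ ‖Ñ_i‖` — the discrete form of Coppel's inequality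
`‖Φ(T)‖ ≤ κ(V) exp ∫ (max Re Λ + ‖V⁻¹V'‖)`: each `‖Ñ_i‖` is bounded by
`exp(h · (frozen abscissa in the frame + frame-rotation rate))`.  Stated for continuous linear maps of
a normed space (operator norm); pure bookkeeping.
-/

namespace Summit.AnomalousDissipation.AnomalousDissipation.Theorems

variable {𝕜 E : Type*} [NontriviallyNormedField 𝕜] [NormedAddCommGroup E] [NormedSpace 𝕜 E]

/-- Ordered product of propagators: `stepProd M N = M (N-1) ∘ ⋯ ∘ M 0` (`= id` for `N = 0`). -/
def stepProd (M : ℕ → E →L[𝕜] E) : ℕ → E →L[𝕜] E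
  | 0 => ContinuousLinearMap.id 𝕜 E
  | N + 1 => (M N).comp (stepProd M N)

/-- Unfolding lemma, `N = 0`. -/
theorem stepProd_zero (M : ℕ → E →L[𝕜] E) :
    stepProd M 0 = ContinuousLinearMap.id 𝕜 E := rfl

/-- Unfolding lemma, successor. -/
theorem stepProd_succ (M : ℕ → E →L[𝕜] E) (N : ℕ) :
    stepProd M (N + 1) = (M N).comp (stepProd M N) := rfl

/-- The conjugated ("moving-frame") factors `Ñ_i = V_{i+1}⁻¹ ∘ M_i ∘ V_i`. -/
def frameStep (M : ℕ → E →L[𝕜] E) (V : ℕ → E ≃L[𝕜] E) (i : ℕ) : E →L[𝕜] E :=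
  ((V (i + 1)).symm : E →L[𝕜] E).comp ((M i).comp (V i : E →L[𝕜] E))

/-- **Telescoping identity**: `M_{N-1} ∘ ⋯ ∘ M_0 = V_N ∘ (Ñ_{N-1} ∘ ⋯ ∘ Ñ_0) ∘ V_0⁻¹`. -/
theorem stepProd_eq_frame (M : ℕ → E →L[𝕜] E) (V : ℕ → E ≃L[𝕜] E) (N : ℕ) :
    stepProd M N = (V N : E →L[𝕜] E).comp ((stepProd (frameStep M V) N).comp ((V 0).symm : E →L[𝕜] E)) := by
  induction N with
  | zero =>
    ext x
    simp [stepProd]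
  | succ N ih =>
    ext x
    simp [stepProd, frameStep, ih]

/-- Submultiplicativity along the product: `‖M_{N-1} ∘ ⋯ ∘ M_0‖ ≤ ∏_{i<N} ‖M_i‖`. -/
theorem norm_stepProd_le (M : ℕ → E →L[𝕜] E) (N : ℕ) :
    ‖stepProd M N‖ ≤ ∏ i ∈ Finset.range N, ‖M i‖ := by
  induction N with
  | zero =>
    simp only [stepProd, Finset.range_zero, Finset.prod_empty]
    exact ContinuousLinearMap.norm_id_le
  | succ N ih =>
    rw [stepProd_succ, Finset.prod_range_succ, mul_comm]
    exact (ContinuousLinearMap.opNorm_comp_le _ _).trans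
      (mul_le_mul_of_nonneg_left ih (norm_nonneg _))

/-- **Discrete Coppel inequality**: `‖M_{N-1} ∘ ⋯ ∘ M_0‖ ≤ ‖V_N‖ · (∏_{i<N} ‖V_{i+1}⁻¹ M_i V_i‖) · ‖V_0⁻¹‖`. -/
theorem norm_stepProd_le_frame (M : ℕ → E →L[𝕜] E) (V : ℕ → E ≃L[𝕜] E) (N : ℕ) :
    ‖stepProd M N‖ ≤ ‖(V N : E →L[𝕜] E)‖ * (∏ i ∈ Finset.range N, ‖frameStep M V i‖) *
      ‖((V 0).symm : E →L[𝕜] E)‖ := by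
  rw [stepProd_eq_frame M V N]
  refine (ContinuousLinearMap.opNorm_comp_le _ _).trans ?_
  rw [mul_assoc]
  refine mul_le_mul_of_nonneg_left ?_ (norm_nonneg _)
  exact (ContinuousLinearMap.opNorm_comp_le _ _).trans
    (mul_le_mul_of_nonneg_right (norm_stepProd_le _ _) (norm_nonneg _))

/-- Exponential form: if each frame step satisfies `‖Ñ_i‖ ≤ exp (h i * μ i)` (frozen abscissa plus
frame-rotation rate over a step of length `h i`), then
`‖Φ‖ ≤ ‖V_N‖ ‖V_0⁻¹‖ exp (∑ h i μ i)`. -/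
theorem norm_stepProd_le_exp (M : ℕ → E →L[𝕜] E) (V : ℕ → E ≃L[𝕜] E) (N : ℕ) (h μ : ℕ → ℝ)
    (hstep : ∀ i < N, ‖frameStep M V i‖ ≤ Real.exp (h i * μ i)) :
    ‖stepProd M N‖ ≤ ‖(V N : E →L[𝕜] E)‖ * ‖((V 0).symm : E →L[𝕜] E)‖ *
      Real.exp (∑ i ∈ Finset.range N, h i * μ i) := by
  have hprod : ∏ i ∈ Finset.range N, ‖frameStep M V i‖ ≤ Real.exp (∑ i ∈ Finset.range N, h i * μ i) := by
    rw [Real.exp_sum]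
    exact Finset.prod_le_prod (fun i _ => norm_nonneg _) (fun i hi => hstep i (Finset.mem_range.mp hi))
  calc ‖stepProd M N‖
      ≤ ‖(V N : E →L[𝕜] E)‖ * (∏ i ∈ Finset.range N, ‖frameStep M V i‖) * ‖((V 0).symm : E →L[𝕜] E)‖ :=
        norm_stepProd_le_frame M V N
    _ ≤ ‖(V N : E →L[𝕜] E)‖ * Real.exp (∑ i ∈ Finset.range N, h i * μ i) * ‖((V 0).symm : E →L[𝕜] E)‖ := by
        gcongr
    _ = _ := by ring

end Summit.AnomalousDissipation.AnomalousDissipation.Theorems
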